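import Summits.AtomisticToContinuum.Crystallization.Theorems.PricedLinkCensusStackingHingeRelaxedStarRigidityStar

/-!
# Route `PricedLinkCensus`, crux `StackingHinge` (stmt-AtomisticToContinuum-14993), line `Sketch`:
# exact-star rigidity off the ideal ratio, II — isometries fixing `± e₃` and the two local steps

Support file 2 of 4 for the registered stub `stub_relaxedStarRigidity` (pure geometry).

First part: linear isometries `B` of `ℝ³` with `B e₃ = ± e₃` — closure under inverse and
composition, preservation of heights up to sign, and the criterion `axial_of_inPlane`: a linear
isometry mapping two independent vectors of the plane `x₂ = 0` into that plane fixes `± e₃`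
(a `2 × 2` determinant with the preserved Gram matrix).

Second part: the two LOCAL steps of the rigidity argument, for a set `S ∋ 0` whose punctured
`5/4`-ball at `0` is exactly `refStar a h` (`h ≠ a√(2/3)`, parameter box) and a star point
`r ∈ refStar a h`:

* `not_fcc_of_neighbour` (TYPES DO NOT MIX): the punctured ball of `S` at `r` is not a rotated
  `a • fccKissingPattern` — some point of `S` is at distance `ρ = √(a²/3 + h²) ≠ a` from `r`
  (`0` if `r` is polar, a polar point over a hole adjacent to `r` if `r` is in-layer);
* `axial_of_neighbour` (THE LAYER NORMAL PROPAGATES): if the punctured ball of `S` at `r` is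
  `B '' refStar a h` then `B e₃ = ± e₃` — for in-layer `r` the struts `−r`, `r' − r` of `r`
  (`r'` an adjacent in-layer point) have length `a`, hence in-layer preimages under `B`; for polar
  `r` the triangle `{0, t, t'}` under `r` consists of points at distance `ρ` from `r`, whose
  preimages are polar and pairwise `a < 2h` apart, hence at a common height; either way `B⁻¹`
  maps two independent in-layer vectors into the layer plane.

Both are then transported to an arbitrary centre `x` with rotation `A_x` (`not_fcc_of_adj`,
`axial_of_adj`) by normalising `S` to `A_x⁻¹ (S − x)` (`normalize_at`).  All `[folklore]`.
-/

noncomputable section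

namespace Summit.AtomisticToContinuum.Crystallization.Theorems.PricedHcpWindowsRelaxedStarRigidity

open Literature.MathematicalPhysics.StatisticalMechanics Literature.Geometry.DiscreteGeometry
open Summit.AtomisticToContinuum.Crystallization.Theorems.PalmUnimodularRigidity.LayeredLawsSelectHcp
open Summit.AtomisticToContinuum.Crystallization.Theorems.PricedHcpWindowsIdealStarRigidity
open Summit.AtomisticToContinuum.Crystallization.Theorems.PricedHcpWindowsHcpLocalExactRigid
open Summit.AtomisticToContinuum.Crystallization.Theorems.PricedHcpWindowsBarlowShellSupport

/-! ## Isometries fixing `± e₃` -/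

/-- If `B e₃ = ± e₃` then `B⁻¹ e₃ = ± e₃`. [folklore] -/
theorem axial_symm {B : EuclideanSpace ℝ (Fin 3) ≃ₗᵢ[ℝ] EuclideanSpace ℝ (Fin 3)}
    (hB : B layerAxis = layerAxis ∨ B layerAxis = -layerAxis) :
    B.symm layerAxis = layerAxis ∨ B.symm layerAxis = -layerAxis := by
  rcases hB with h | h
  · left
    have := congrArg B.symm h
    rw [B.symm_apply_apply] at this
    exact this.symm
  · right
    have := congrArg B.symm h
    rw [B.symm_apply_apply, map_neg] at this
    have := congrArg Neg.neg this
    rw [neg_neg] at this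
    exact this.symm

/-- If `B e₃ = ± e₃` and `C e₃ = ± e₃` then `(C ∘ B) e₃ = ± e₃`. [folklore] -/
theorem axial_trans {B C : EuclideanSpace ℝ (Fin 3) ≃ₗᵢ[ℝ] EuclideanSpace ℝ (Fin 3)}
    (hB : B layerAxis = layerAxis ∨ B layerAxis = -layerAxis)
    (hC : C layerAxis = layerAxis ∨ C layerAxis = -layerAxis) :
    (B.trans C) layerAxis = layerAxis ∨ (B.trans C) layerAxis = -layerAxis := by
  rw [LinearIsometryEquiv.trans_apply]
  rcases hB with h | h <;> rw [h] <;> rcases hC with h' | h'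
  · exact Or.inl h'
  · exact Or.inr h'
  · right; rw [map_neg, h']
  · left; rw [map_neg, h', neg_neg]

/-- If `B e₃ = ± e₃` and `(B⁻¹ ∘ C) e₃ = ± e₃` then `C e₃ = ± e₃`. [folklore] -/
theorem axial_of_trans_symm {B C : EuclideanSpace ℝ (Fin 3) ≃ₗᵢ[ℝ] EuclideanSpace ℝ (Fin 3)}
    (hB : B layerAxis = layerAxis ∨ B layerAxis = -layerAxis)
    (hCB : (C.trans B.symm) layerAxis = layerAxis ∨ (C.trans B.symm) layerAxis = -layerAxis) :
    C layerAxis = layerAxis ∨ C layerAxis = -layerAxis := by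
  have : C = (C.trans B.symm).trans B := by ext x; simp
  rw [this]
  exact axial_trans hCB hB

/-- An isometry fixing `e₃` preserves heights: `(B z)₂ = z₂`. [folklore] -/
theorem apply_two_of_map_layerAxis {B : EuclideanSpace ℝ (Fin 3) ≃ₗᵢ[ℝ] EuclideanSpace ℝ (Fin 3)}
    (h : B layerAxis = layerAxis) (z : EuclideanSpace ℝ (Fin 3)) : B z 2 = z 2 := by
  rw [← inner_layerAxis_left, ← h, LinearIsometryEquiv.inner_map_map, inner_layerAxis_left]

/-- An isometry reversing `e₃` reverses heights: `(B z)₂ = −z₂`. [folklore] -/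
theorem apply_two_of_map_layerAxis_neg {B : EuclideanSpace ℝ (Fin 3) ≃ₗᵢ[ℝ] EuclideanSpace ℝ (Fin 3)}
    (h : B layerAxis = -layerAxis) (z : EuclideanSpace ℝ (Fin 3)) : B z 2 = -z 2 := by
  have h' : layerAxis = -B layerAxis := by rw [h, neg_neg]
  rw [← inner_layerAxis_left (B z), h', inner_neg_left, LinearIsometryEquiv.inner_map_map,
    inner_layerAxis_left]

/-- **A linear isometry mapping two independent vectors of the plane `x₂ = 0` into that plane
fixes `± e₃`.**  With `n = B e₃`, `p = B y`, `p' = B y'`: `n ⊥ p, p'`, and the `2 × 2` determinant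
of `(p, p')` squares to that of `(y, y')` (Lagrange's identity with the preserved Gram matrix), so
`n₀ = n₁ = 0`, `n₂ = ± 1`. [folklore] -/
theorem axial_of_inPlane (B : EuclideanSpace ℝ (Fin 3) ≃ₗᵢ[ℝ] EuclideanSpace ℝ (Fin 3))
    {y y' : EuclideanSpace ℝ (Fin 3)} (hy : y 2 = 0) (hy' : y' 2 = 0)
    (hdet : y 0 * y' 1 - y 1 * y' 0 ≠ 0) (hBy : B y 2 = 0) (hBy' : B y' 2 = 0) :
    B layerAxis = layerAxis ∨ B layerAxis = -layerAxis := by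
  have h1 : inner ℝ (B layerAxis) (B y) = 0 := by
    rw [LinearIsometryEquiv.inner_map_map, inner_layerAxis_left, hy]
  have h2 : inner ℝ (B layerAxis) (B y') = 0 := by
    rw [LinearIsometryEquiv.inner_map_map, inner_layerAxis_left, hy']
  have h3 : inner ℝ (B y) (B y) = inner ℝ y y := B.inner_map_map y y
  have h4 : inner ℝ (B y') (B y') = inner ℝ y' y' := B.inner_map_map y' y'
  have h5 : inner ℝ (B y) (B y') = inner ℝ y y' := B.inner_map_map y y'
  have h6 : ‖B layerAxis‖ = 1 := by rw [LinearIsometryEquiv.norm_map]; simp [layerAxis]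
  have hsq : ‖B layerAxis‖ ^ 2 = B layerAxis 0 ^ 2 + B layerAxis 1 ^ 2 + B layerAxis 2 ^ 2 :=
    norm_sq_eq_three _
  set n := B layerAxis with hn
  set p := B y with hp
  set p' := B y' with hp'
  clear_value n p p'
  rw [real_inner_eq_sum_three] at h1 h2 h3 h4 h5
  rw [real_inner_eq_sum_three] at h3 h4 h5
  rw [hBy] at h1 h3 h5
  rw [hBy'] at h2 h4 h5
  rw [hy] at h3 h5
  rw [hy'] at h4 h5
  have hD : (p 0 * p' 1 - p 1 * p' 0) ^ 2 = (y 0 * y' 1 - y 1 * y' 0) ^ 2 := by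
    linear_combination (p' 0 ^ 2 + p' 1 ^ 2) * h3 + (y 0 ^ 2 + y 1 ^ 2) * h4 -
      (p 0 * p' 0 + p 1 * p' 1 + (y 0 * y' 0 + y 1 * y' 1)) * h5
  have hD' : p 0 * p' 1 - p 1 * p' 0 ≠ 0 := by
    intro h0
    rw [h0, eq_comm] at hD
    exact hdet (pow_eq_zero_iff two_ne_zero |>.1 (by simpa using hD))
  have hn0 : n 0 = 0 := by
    have : n 0 * (p 0 * p' 1 - p 1 * p' 0) = 0 := by
      linear_combination (p' 1) * h1 - (p 1) * h2
    exact (mul_eq_zero.1 this).resolve_right hD'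
  have hn1 : n 1 = 0 := by
    have : n 1 * (p 0 * p' 1 - p 1 * p' 0) = 0 := by
      linear_combination -(p' 0) * h1 + (p 0) * h2
    exact (mul_eq_zero.1 this).resolve_right hD'
  have hn2 : n 2 = 1 ∨ n 2 = -1 := by
    rw [h6, hn0, hn1] at hsq
    have : (n 2 - 1) * (n 2 + 1) = 0 := by nlinarith
    rcases mul_eq_zero.1 this with h | h
    · left; linarith
    · right; linarith
  obtain ⟨a0, a1, a2⟩ := layerAxis_apply
  rcases hn2 with h | h
  · left
    ext i
    fin_cases i
    · simp only [Fin.zero_eta, hn0, a0]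
    · simp only [Fin.mk_one, hn1, a1]
    · simp only [Fin.reduceFinMk, h, a2]
  · right
    ext i
    fin_cases i
    · simp only [Fin.zero_eta, hn0, PiLp.neg_apply, a0, neg_zero]
    · simp only [Fin.mk_one, hn1, PiLp.neg_apply, a1, neg_zero]
    · simp only [Fin.reduceFinMk, h, PiLp.neg_apply, a2]

/-! ## The two local steps at the origin -/

section Local

variable {a h : ℝ} (ha₁ : 189 / 200 ≤ a) (ha₂ : a ≤ 199 / 200) (hh₁ : 77 / 100 ≤ h)
  (hh₂ : h ≤ 163 / 200) (hne : h ≠ a * Real.sqrt (2 / 3))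
include ha₁ ha₂ hh₁ hh₂ hne

/-- **Types do not mix.**  If the punctured ball of `S ∋ 0` at `0` is exactly `refStar a h`
(`h ≠ a√(2/3)`) and `r` is one of its points, then the punctured ball of `S` at `r` is not a
rotated `a • fccKissingPattern`: some point of `S` is at distance `ρ = √(a²/3 + h²) ≠ a` from `r`
— the origin if `r` is polar, a polar point over a hole adjacent to `r` if `r` is in-layer.
[folklore] -/
theorem not_fcc_of_neighbour {S : Set (EuclideanSpace ℝ (Fin 3))}
    (h0 : (0 : EuclideanSpace ℝ (Fin 3)) ∈ S)
    (hR : pball S 0 = (refStar a h : Set (EuclideanSpace ℝ (Fin 3))))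
    {r : EuclideanSpace ℝ (Fin 3)} (hr : r ∈ (refStar a h : Set (EuclideanSpace ℝ (Fin 3))))
    {B : EuclideanSpace ℝ (Fin 3) ≃ₗᵢ[ℝ] EuclideanSpace ℝ (Fin 3)}
    (hB : pball S r = B '' ((fun p : EuclideanSpace ℝ (Fin 3) => a • p) ''
      (fccKissingPattern : Set (EuclideanSpace ℝ (Fin 3))))) : False := by
  have ha : 0 < a := by linarith
  have hh : 0 < h := by linarith
  have hρ := rho_sq_ne ha₁ hh₁ hne
  have hρle := rho_sq_le ha₁ ha₂ hh₁ hh₂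
  -- points of `S` near `r` are at distance exactly `a`
  have hnorm : ∀ z ∈ S, z ≠ r → dist z r ≤ 5 / 4 → dist z r = a := by
    intro z hz hzr hd
    have hmem := sub_mem_pball hz hzr hd
    rw [hB] at hmem
    rw [dist_eq_norm]
    exact norm_of_mem_image_fcc ha.le B hmem
  have hRS : ∀ y ∈ (refStar a h : Set (EuclideanSpace ℝ (Fin 3))), y ∈ S := fun y hy => by
    rw [← hR, mem_pball_iff, zero_add] at hy
    exact hy.1
  obtain ⟨v, hv, rfl⟩ := mem_coe_refStar_iff.1 hr
  rcases starIdx_facts.1 v hv with ⟨hk, -⟩ | ⟨-, hq⟩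
  · obtain ⟨w, hw, hqw⟩ := starIdx_facts.2.2.1 v hv hk
    have hdsq := dist_sq_hcpSite_of_siteQ_eq (a := a) (h := h) hqw
    obtain ⟨hpos, hle⟩ := dist_bounds_of_sq_eq dist_nonneg hρle hh hdsq
    have hd := hnorm _ (hRS _ (hcpSite_mem_refStar hw)) (dist_pos.1 hpos) hle
    rw [hd] at hdsq
    exact hρ hdsq.symm
  · have hnsq := norm_sq_hcpSite_of_siteQ_eq (a := a) (h := h) hq
    rw [← dist_zero_left] at hnsq
    obtain ⟨hpos, hle⟩ := dist_bounds_of_sq_eq dist_nonneg hρle hh hnsq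
    have hd := hnorm 0 h0 (dist_pos.1 hpos) hle
    rw [hd] at hnsq
    exact hρ hnsq.symm

/-- **The layer normal propagates.**  If the punctured ball of `S ∋ 0` at `0` is exactly
`refStar a h` (`h ≠ a√(2/3)`), `r` is one of its points and the punctured ball of `S` at `r` is
`B '' refStar a h`, then `B e₃ = ± e₃`.  In-layer `r`: the preimages of `−r` and `r' − r` (`r'` an
adjacent in-layer point) have length `a`, so are in-layer; polar `r`: the preimages of `−r`,
`t − r`, `t' − r` (`{0, t, t'}` the triangle under `r`) are polar and pairwise `a < 2h` apart, so at
a common height; either way `B⁻¹` maps two independent in-layer vectors into the layer plane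
(`axial_of_inPlane`). [folklore] -/
theorem axial_of_neighbour {S : Set (EuclideanSpace ℝ (Fin 3))}
    (h0 : (0 : EuclideanSpace ℝ (Fin 3)) ∈ S)
    (hR : pball S 0 = (refStar a h : Set (EuclideanSpace ℝ (Fin 3))))
    {r : EuclideanSpace ℝ (Fin 3)} (hr : r ∈ (refStar a h : Set (EuclideanSpace ℝ (Fin 3))))
    {B : EuclideanSpace ℝ (Fin 3) ≃ₗᵢ[ℝ] EuclideanSpace ℝ (Fin 3)}
    (hB : pball S r = B '' (refStar a h : Set (EuclideanSpace ℝ (Fin 3)))) :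
    B layerAxis = layerAxis ∨ B layerAxis = -layerAxis := by
  have ha : 0 < a := by linarith
  have hh : 0 < h := by linarith
  have hρ := rho_sq_ne ha₁ hh₁ hne
  have hρle := rho_sq_le ha₁ ha₂ hh₁ hh₂
  have ha54 : a ≤ 5 / 4 := by linarith
  have hRS : ∀ y ∈ (refStar a h : Set (EuclideanSpace ℝ (Fin 3))), y ∈ S := fun y hy => by
    rw [← hR, mem_pball_iff, zero_add] at hy
    exact hy.1
  -- preimages of the struts of `r`
  have hpre : ∀ z ∈ S, z ≠ r → dist z r ≤ 5 / 4 →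
      B.symm (z - r) ∈ (refStar a h : Set (EuclideanSpace ℝ (Fin 3))) ∧
        ‖B.symm (z - r)‖ = dist z r := by
    intro z hz hzr hd
    have hmem := sub_mem_pball hz hzr hd
    rw [hB] at hmem
    obtain ⟨q, hq, hqe⟩ := hmem
    refine ⟨?_, by rw [LinearIsometryEquiv.norm_map, dist_eq_norm]⟩
    rw [← hqe, B.symm_apply_apply]
    exact hq
  suffices hsymm : B.symm layerAxis = layerAxis ∨ B.symm layerAxis = -layerAxis by
    have := axial_symm hsymm
    rwa [LinearIsometryEquiv.symm_symm] at this
  obtain ⟨v, hv, rfl⟩ := mem_coe_refStar_iff.1 hr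
  rcases starIdx_facts.1 v hv with ⟨hk, hq⟩ | ⟨hk, hq⟩
  · -- in-layer `r`
    obtain ⟨w, hw, hwk, -, hqw, hdet⟩ := starIdx_facts.2.2.2.1 v hv hk
    have hrn : ‖hcpSite a h v‖ = a := norm_hcpSite_of_siteQ_eq ha.le hq
    have hd : dist (hcpSite a h w) (hcpSite a h v) = a := dist_hcpSite_of_siteQ_eq ha.le hqw
    have hne0 : (0 : EuclideanSpace ℝ (Fin 3)) ≠ hcpSite a h v := by
      intro heq; rw [← heq, norm_zero] at hrn; linarith
    have hne1 : hcpSite a h w ≠ hcpSite a h v := by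
      intro heq; rw [heq, dist_self] at hd; linarith
    obtain ⟨hq0, hq0n⟩ := hpre 0 h0 hne0 (by rwa [dist_zero_left, hrn])
    rw [dist_zero_left, hrn] at hq0n
    obtain ⟨hq1, hq1n⟩ := hpre _ (hRS _ (hcpSite_mem_refStar hw)) hne1 (by rw [hd]; exact ha54)
    rw [hd] at hq1n
    have h0two : B.symm (hcpSite a h v) 2 = 0 := by
      have := apply_two_eq_zero_of_norm_eq ha.le hρ hq0 hq0n
      rw [zero_sub, map_neg] at this
      simpa using this
    have h1two : B.symm (hcpSite a h w) 2 = 0 := by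
      have := apply_two_eq_zero_of_norm_eq ha.le hρ hq1 hq1n
      rw [map_sub, PiLp.sub_apply, h0two, sub_zero] at this
      exact this
    exact axial_of_inPlane B.symm (by rw [hcpSite_apply_two, hk]; simp)
      (by rw [hcpSite_apply_two, hwk]; simp) (det_hcpSite_ne_zero ha.ne' hdet) h0two h1two
  · -- polar `r`
    have hk' : v.1 ≠ 0 := by rcases hk with hk | hk <;> rw [hk] <;> decide
    obtain ⟨w, hw, w', hw', hwk, hw'k, hw0, hw'0, hqw, hqw', hdet⟩ := starIdx_facts.2.2.2.2 v hv hk'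
    -- heights of polar preimages
    have key : ∀ q ∈ (refStar a h : Set (EuclideanSpace ℝ (Fin 3))), ‖q‖ ^ 2 = a ^ 2 / 3 + h ^ 2 →
        q 2 = h ∨ q 2 = -h := fun q hq' hqn =>
      (apply_two_of_norm_ne ha.le hq' (fun h' => hρ (by rw [← hqn, h']))).2
    have two_diff : ∀ q q' : EuclideanSpace ℝ (Fin 3), (q 2 = h ∨ q 2 = -h) →
        (q' 2 = h ∨ q' 2 = -h) → ‖q - q'‖ = a → (q - q') 2 = 0 := by
      intro q q' hq2 hq'2 hn
      have hle : |(q - q') 2| ≤ ‖q - q'‖ := by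
        have := PiLp.norm_apply_le (q - q') 2
        rwa [Real.norm_eq_abs] at this
      rw [hn, PiLp.sub_apply] at hle
      rw [PiLp.sub_apply]
      rcases hq2 with h2 | h2 <;> rcases hq'2 with h2' | h2' <;> rw [h2, h2'] at hle ⊢
      · ring
      · rw [sub_neg_eq_add, abs_of_pos (by linarith)] at hle; linarith
      · rw [show -h - h = -(2 * h) by ring, abs_neg, abs_of_pos (by linarith)] at hle; linarith
      · ring
    -- the three points `0, t, t'` under `r`
    have hnsq := norm_sq_hcpSite_of_siteQ_eq (a := a) (h := h) hq
    rw [← dist_zero_left] at hnsq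
    have hdt := dist_sq_hcpSite_of_siteQ_eq (a := a) (h := h) hqw
    have hdt' := dist_sq_hcpSite_of_siteQ_eq (a := a) (h := h) hqw'
    obtain ⟨hp0, hl0⟩ := dist_bounds_of_sq_eq dist_nonneg hρle hh hnsq
    obtain ⟨hpt, hlt⟩ := dist_bounds_of_sq_eq dist_nonneg hρle hh hdt
    obtain ⟨hpt', hlt'⟩ := dist_bounds_of_sq_eq dist_nonneg hρle hh hdt'
    obtain ⟨hq0, hq0n⟩ := hpre 0 h0 (dist_pos.1 hp0) hl0
    obtain ⟨hqt, hqtn⟩ := hpre _ (hRS _ (hcpSite_mem_refStar hw)) (dist_pos.1 hpt) hlt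
    obtain ⟨hqt', hqt'n⟩ := hpre _ (hRS _ (hcpSite_mem_refStar hw')) (dist_pos.1 hpt') hlt'
    have c0 := key _ hq0 (by rw [hq0n, hnsq])
    have ct := key _ hqt (by rw [hqtn, hdt])
    have ct' := key _ hqt' (by rw [hqt'n, hdt'])
    have hBt : ∀ {u : ℤ × ℤ × ℤ}, siteQ u 0 = (12, 0) →
        (B.symm (hcpSite a h u - hcpSite a h v) 2 = h ∨ B.symm (hcpSite a h u - hcpSite a h v) 2 = -h) →
        B.symm (hcpSite a h u) 2 = 0 := by
      intro u hu0 cu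
      have e : B.symm (hcpSite a h u) =
          B.symm (hcpSite a h u - hcpSite a h v) - B.symm (0 - hcpSite a h v) := by
        rw [← map_sub]; congr 1; abel
      rw [e]
      refine two_diff _ _ cu c0 ?_
      rw [← e, LinearIsometryEquiv.norm_map]
      exact norm_hcpSite_of_siteQ_eq ha.le hu0
    exact axial_of_inPlane B.symm (by rw [hcpSite_apply_two, hwk]; simp)
      (by rw [hcpSite_apply_two, hw'k]; simp) (det_hcpSite_ne_zero ha.ne' hdet) (hBt hw0 ct)
      (hBt hw'0 ct')

end Local

/-! ## The two local steps at an arbitrary centre -/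

section Adj

variable {a h : ℝ} (ha₁ : 189 / 200 ≤ a) (ha₂ : a ≤ 199 / 200) (hh₁ : 77 / 100 ≤ h)
  (hh₂ : h ≤ 163 / 200) (hne : h ≠ a * Real.sqrt (2 / 3))
include ha₁ ha₂ hh₁ hh₂ hne

/-- **Types do not mix (transported)**: if `x ∈ S` has punctured ball `A_x '' refStar a h` and
`y − x` lies in it, then the punctured ball of `S` at `y` is not a rotated `a • fccKissingPattern`.
[folklore] -/
theorem not_fcc_of_adj {S : Set (EuclideanSpace ℝ (Fin 3))} {x y : EuclideanSpace ℝ (Fin 3)}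
    (hx : x ∈ S) {Ax : EuclideanSpace ℝ (Fin 3) ≃ₗᵢ[ℝ] EuclideanSpace ℝ (Fin 3)}
    (hPx : pball S x = Ax '' (refStar a h : Set (EuclideanSpace ℝ (Fin 3))))
    (hy : y - x ∈ pball S x) {Ay : EuclideanSpace ℝ (Fin 3) ≃ₗᵢ[ℝ] EuclideanSpace ℝ (Fin 3)}
    (hPy : pball S y = Ay '' ((fun p : EuclideanSpace ℝ (Fin 3) => a • p) ''
      (fccKissingPattern : Set (EuclideanSpace ℝ (Fin 3))))) : False := by
  obtain ⟨h0', hP'⟩ := normalize_at hx Ax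
  have hR' : pball (Ax.symm '' ((fun p : EuclideanSpace ℝ (Fin 3) => p - x) '' S)) 0 =
      (refStar a h : Set (EuclideanSpace ℝ (Fin 3))) := by
    have e1 : (Ax.symm '' (Ax '' (refStar a h : Set (EuclideanSpace ℝ (Fin 3))))) =
        (refStar a h : Set (EuclideanSpace ℝ (Fin 3))) := by
      rw [Set.image_image]; simp
    have := hP' x
    rwa [sub_self, map_zero, hPx, e1] at this
  have hr : Ax.symm (y - x) ∈ (refStar a h : Set (EuclideanSpace ℝ (Fin 3))) := by
    rw [hPx] at hy
    obtain ⟨q, hq, hqe⟩ := hy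
    rw [← hqe, Ax.symm_apply_apply]
    exact hq
  have e2 : ∀ X : Set (EuclideanSpace ℝ (Fin 3)), Ax.symm '' (Ay '' X) = (Ay.trans Ax.symm) '' X :=
    fun X => by rw [Set.image_image]; rfl
  have hB := hP' y
  rw [hPy, e2] at hB
  exact not_fcc_of_neighbour ha₁ ha₂ hh₁ hh₂ hne h0' hR' hr (B := Ay.trans Ax.symm) hB

/-- **The layer normal propagates (transported)**: if `x ∈ S` has punctured ball
`A_x '' refStar a h` with `A_x e₃ = ± e₃`, `y − x` lies in it, and the punctured ball of `S` at `y`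
is `A_y '' refStar a h`, then `A_y e₃ = ± e₃`. [folklore] -/
theorem axial_of_adj {S : Set (EuclideanSpace ℝ (Fin 3))} {x y : EuclideanSpace ℝ (Fin 3)}
    (hx : x ∈ S) {Ax : EuclideanSpace ℝ (Fin 3) ≃ₗᵢ[ℝ] EuclideanSpace ℝ (Fin 3)}
    (hPx : pball S x = Ax '' (refStar a h : Set (EuclideanSpace ℝ (Fin 3))))
    (hAx : Ax layerAxis = layerAxis ∨ Ax layerAxis = -layerAxis)
    (hy : y - x ∈ pball S x) {Ay : EuclideanSpace ℝ (Fin 3) ≃ₗᵢ[ℝ] EuclideanSpace ℝ (Fin 3)}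
    (hPy : pball S y = Ay '' (refStar a h : Set (EuclideanSpace ℝ (Fin 3)))) :
    Ay layerAxis = layerAxis ∨ Ay layerAxis = -layerAxis := by
  obtain ⟨h0', hP'⟩ := normalize_at hx Ax
  have hR' : pball (Ax.symm '' ((fun p : EuclideanSpace ℝ (Fin 3) => p - x) '' S)) 0 =
      (refStar a h : Set (EuclideanSpace ℝ (Fin 3))) := by
    have e1 : (Ax.symm '' (Ax '' (refStar a h : Set (EuclideanSpace ℝ (Fin 3))))) =
        (refStar a h : Set (EuclideanSpace ℝ (Fin 3))) := by
      rw [Set.image_image]; simp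
    have := hP' x
    rwa [sub_self, map_zero, hPx, e1] at this
  have hr : Ax.symm (y - x) ∈ (refStar a h : Set (EuclideanSpace ℝ (Fin 3))) := by
    rw [hPx] at hy
    obtain ⟨q, hq, hqe⟩ := hy
    rw [← hqe, Ax.symm_apply_apply]
    exact hq
  have e2 : ∀ X : Set (EuclideanSpace ℝ (Fin 3)), Ax.symm '' (Ay '' X) = (Ay.trans Ax.symm) '' X :=
    fun X => by rw [Set.image_image]; rfl
  have hB := hP' y
  rw [hPy, e2] at hB
  exact axial_of_trans_symm hAx
    (axial_of_neighbour ha₁ ha₂ hh₁ hh₂ hne h0' hR' hr (B := Ay.trans Ax.symm) hB)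

end Adj

/-! ## Registered sub-goal -/

/-- **Registered sub-goal `stub_relaxedStarAxialNeighbour` of stmt-AtomisticToContinuum-14993 (anchor of
this support file): the layer normal propagates to star points.**  On the parameter box with
`h ≠ a √(2/3)`: if `0 ∈ S`, the punctured `5/4`-ball of `S` at `0` is exactly `refStar a h`, `r` is
one of its points, and the punctured `5/4`-ball of `S` at `r` is `B '' refStar a h` for a linear
isometry `B`, then `B e₃ = ± e₃` (`axial_of_neighbour`). [folklore] -/
theorem stub_relaxedStarAxialNeighbour : ∀ a h : ℝ, 189 / 200 ≤ a → a ≤ 199 / 200 → 77 / 100 ≤ h → h ≤ 163 / 200 → h ≠ a * Real.sqrt (2 / 3) → ∀ S : Set (EuclideanSpace ℝ (Fin 3)), (0 : EuclideanSpace ℝ (Fin 3)) ∈ S → {y : EuclideanSpace ℝ (Fin 3) | y ∈ ((fun p : EuclideanSpace ℝ (Fin 3) => p - 0) '' S) ∧ y ≠ 0 ∧ ‖y‖ ≤ 5 / 4} = (↑(Summit.AtomisticToContinuum.Crystallization.Theorems.PalmUnimodularRigidity.LayeredLawsSelectHcp.refStar a h) : Set (EuclideanSpace ℝ (Fin 3)))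 → ∀ r ∈ (↑(Summit.AtomisticToContinuum.Crystallization.Theorems.PalmUnimodularRigidity.LayeredLawsSelectHcp.refStar a h) : Set (EuclideanSpace ℝ (Fin 3))), ∀ B : EuclideanSpace ℝ (Fin 3) ≃ₗᵢ[ℝ] EuclideanSpace ℝ (Fin 3), {y : EuclideanSpace ℝ (Fin 3) | y ∈ ((fun p : EuclideanSpace ℝ (Fin 3) => p - r) '' S) ∧ y ≠ 0 ∧ ‖y‖ ≤ 5 / 4} = B '' (↑(Summit.AtomisticToContinuum.Crystallization.Theorems.PalmUnimodularRigidity.LayeredLawsSelectHcp.refStar a h) : Set (EuclideanSpace ℝ (Fin 3))) → (B (EuclideanSpace.single 2 1) = EuclideanSpace.single 2 1 ∨ B (EuclideanSpace.single 2 1) = -EuclideanSpace.single 2 1) := by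
  intro a h ha₁ ha₂ hh₁ hh₂ hne S h0 hR r hr B hB
  exact axial_of_neighbour ha₁ ha₂ hh₁ hh₂ hne h0 hR hr hB

end Summit.AtomisticToContinuum.Crystallization.Theorems.PricedHcpWindowsRelaxedStarRigidity

end
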